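import Summits.BirchSwinnertonDyer.BirchSwinnertonDyer.Theorems.QuadraticBranchSignedControlPlusEtaLowerInclusionRankZeroPairsTamagawa
import Literature.NumberTheory.EllipticCurves.SelmerCorankControlCoinvariantsProofs
import Literature.NumberTheory.EllipticCurves.IwasawaEulerCharDualityProofs
import Mathlib.GroupTheory.Torsion
import HarnessLib

/-!
# Route `QuadraticBranchSignedControl` (rung K8, cell `bsd-potss`), crux `PlusEtaLowerInclusion`
# (item stmt-BirchSwinnertonDyer-19601): the TAMAGAWA ROAD, part 2 — Pontryagin bookkeeping:
# `#S^Γ[p] ≤ p^{rank_{ℤ_p}(X/TX)} · #(X/TX)_tors`, the `η ↦ W` transport of the dual pair, and the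
# bottom-layer control bijection `Sel^{loc,∞,+}(W/ℚ)[p^m] ≃ Sel⁺(W/ℚ_∞)^Γ[p^m]` (seat `bsd-potss-k8eta-c1` g4)

WHAT. Part 1 (`…TamagawaRoadCount`) bounds `#Sel^{loc,∞,+}(W/ℚ)[p^m]` from BELOW by the Tamagawa
numbers of `W` (Poitou–Tate). To feed p505261's slot `p^v ∣ #(X_η/TX_η)_tors` three pieces of
bookkeeping are needed, all proved here:
* §1 (pure algebra) `natCard_torsionBy_le_pow_finrank_mul_natCard_torsion`: for a finitely generated
  `ℤ_p`-module `N` which is (as a group) the character group of `S`, **`S[p]` is finite and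
  `#S[p] ≤ p^{rank_{ℤ_p} N} · #N_tors`** (`Hom(S[p], ℚ/ℤ)` is a quotient of `N/pN`, and
  `#(N/pN) = p^{rank N} · #N[p]`, tree lemmas of `ZpCorank`); `exists_natCard_torsion_eq_pow`: the
  torsion subgroup of such an `N` is a finite `p`-group.
* §2 (abstract) `isDualPair_comp_addEquiv`: a dual pair `(S', ψ') ↔ X` and an isomorphism
  `Φ : S ≃ S'` with `Φ ∘ ψ = ψ' ∘ Φ` give a dual pair `(S, ψ) ↔ X` (characters pulled back along `Φ`).
  §3 its instance: for EVERY `η`-datum `D` of `V` (object `X⁺(V/K₀ℚ_∞)^η`) and the `p*`-partner `W`,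
  **`D.X` is Pontryagin dual to `Sel⁺(W/ℚ_∞)` in `W`-coordinates with `T = conj_γ − 1`**
  (`exists_isDualPair_strictSigned_of_eta`; the Selmer dictionary (D3⁺)
  `map_h1TransportInfty_strictSignedSelmerInfty_one` of ctrl + `conj_γ Θ_∞ = Θ_∞ conj_γ` for
  `γ ∈ Gal(ℚ̄/K₀)`). This is the "Λ-iso export" g3's memo asked for, in the form that needs no export:
  the SAME module `D.X` carries both dualities.
* §4 `natCard_localPreimage_inf_torsionBy_eq`: **`#Sel^{loc,∞,+}(W/ℚ)[p^m] = #Sel⁺(W/ℚ_∞)^Γ[p^m]`** —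
  the bottom-layer control map `h₀` is a bijection `A₀⁺ ≅ (Sel⁺_∞)^Γ` (injective: `W(ℚ_∞)[p^∞] = 0`,
  x1b file 55; surjective: Greenberg's Lemma 3.2, tree theorem), restricted to the `p^m`-torsion.

HONEST FRAMING (cell `bsd-potss`, run/shared/lean/pub/bsd-potss/; FULL-BSD rank ≤ 1 programme, HUMAN
RULING D-0036/D-0074): TOOL THEOREMS ONLY — no definition, no named Literature fact, no `sorry`, axioms
standard. Nothing here is specific to rank one; the crux 19601 is NOT closed; nothing is booked;
`BSD(W, p)` is claimed for no pair. `--supports stmt-BirchSwinnertonDyer-19601`.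

References: [GreenbergLNM1716] §1 p. 60, §3 Lemma 3.1–3.2 (pp. 85–86); [Kobayashi2003] Def. 2.1
(p. 5), §4 p. 8, Lemma 9.1 (p. 25); [CoatesSchneiderSujatha2003] §3 (30)–(31).
-/

set_option autoImplicit false
set_option linter.dupNamespace false

noncomputable section

open scoped Classical

open CongruenceSubgroup Field NumberField IsDedekindDomain WeierstrassCurve
open Literature.NumberTheory.EllipticCurves
open Literature.NumberTheory.EllipticCurves.ModularForms
open Literature.NumberTheory.GaloisRepresentations
open Literature.NumberTheory.GaloisCohomology
open Literature.NumberTheory.EllipticCurves.IwasawaDual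
open Literature.NumberTheory.EllipticCurves.Kobayashi2003 (localKummerOverOfEmb)
open Summit.BirchSwinnertonDyer.Rank1Residual.Additive
open Summit.BirchSwinnertonDyer.Rank1Residual.Additive.SignedTwist
open Summit.BirchSwinnertonDyer.Rank1Residual.AdditivePotMult

namespace Summit.BirchSwinnertonDyer.BirchSwinnertonDyer.Theorems

namespace TamagawaRoad

/-! ## §1 Pontryagin bookkeeping over `ℤ_p` -/

section Algebra

open scoped AddSubgroup

variable (p : ℕ) [hp : Fact p.Prime]

/-- **`#S[p] ≤ p^{rank_{ℤ_p} N} · #N_tors` when `N ≅ Hom(S, ℚ/ℤ)` is a finitely generated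
`ℤ_p`-module**, and `S[p]` is finite: the restriction `Hom(S, ℚ/ℤ)/p → Hom(S[p], ℚ/ℤ)` is onto
(`ℚ/ℤ` is injective), `#(N/pN) = p^{rank N} · #N[p]` (`ZpCorank.natCard_modN_eq`), `N[p] ≤ N_tors`
(finite), and `#Hom(S[p], ℚ/ℤ) = #S[p]`. [cite: GreenbergLNM1716, §1 (p. 60)] -/
theorem natCard_torsionBy_le_pow_finrank_mul_natCard_torsion
    {S : Type*} [AddCommGroup S] {N : Type*} [AddCommGroup N] [Module ℤ_[p] N] [Module.Finite ℤ_[p] N]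
    (Ψ : N ≃+ CharacterModule S) :
    Finite S[(p : ℤ)] ∧
      Nat.card S[(p : ℤ)] ≤ p ^ Module.finrank ℤ_[p] N * Nat.card (AddCommGroup.torsion N) := by
  obtain ⟨hNmod, -⟩ := ZpCorank.natCard_modN_le p N
  haveI := hNmod
  haveI hfinT : Finite (Submodule.torsion ℤ_[p] N) := ZpCorank.finite_torsion p N
  haveI : Finite N[(p : ℤ)] := ZpCorank.finite_torsionBy p N
  haveI hmodS : Finite (ModN (CharacterModule S) p) := Finite.of_equiv _ (modNEquiv Ψ p).toEquiv
  -- the restriction `Hom(S, ℚ/ℤ)/p → Hom(S[p], ℚ/ℤ)` is onto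
  let r : ModN (CharacterModule S) p →+ CharacterModule (S[(p : ℤ)]) :=
    ModN.liftEquiv.symm
      ⟨(CharacterModule.dual ((S[(p : ℤ)]).subtype.toIntLinearMap)).toAddMonoidHom, fun χ ↦ by
        refine AddMonoidHom.ext fun b ↦ ?_
        show p • χ (b : S) = 0
        rw [← map_nsmul, ← AddSubgroupClass.coe_nsmul, AddSubgroup.torsionBy.nsmul b,
          ZeroMemClass.coe_zero, map_zero]⟩
  have hr : ∀ (χ : CharacterModule S) (b : S[(p : ℤ)]), r (ModN.mkQ p χ) b = χ b := fun _ _ ↦ rfl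
  have hrsurj : Function.Surjective r := by
    intro χ'
    obtain ⟨χ, hχ⟩ := CharacterModule.dual_surjective_of_injective
      ((S[(p : ℤ)]).subtype.toIntLinearMap) (fun a b hab ↦ Subtype.ext hab) χ'
    refine ⟨ModN.mkQ p χ, ?_⟩
    refine CharacterModule.ext (A := ↥(S[(p : ℤ)])) fun b ↦ ?_
    rw [hr, ← hχ]
    rfl
  haveI hfinC : Finite (CharacterModule (S[(p : ℤ)])) := Finite.of_surjective r hrsurj
  haveI hfinS : Finite S[(p : ℤ)] := PontryaginCard.finite_of_finite_characterModule _
  refine ⟨hfinS, ?_⟩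
  -- `N[p] ≤ N_tors`
  have htorsle : Nat.card N[(p : ℤ)] ≤ Nat.card (AddCommGroup.torsion N) := by
    have hsub : ∀ x : N, x ∈ N[(p : ℤ)] → x ∈ AddCommGroup.torsion N := fun x hx ↦ by
      rw [AddCommGroup.mem_torsion, isOfFinAddOrder_iff_nsmul_eq_zero]
      exact ⟨p, hp.out.pos, AddSubgroup.torsionBy.nsmul_iff.mp hx⟩
    have hsub' : ∀ x : N, x ∈ AddCommGroup.torsion N → x ∈ Submodule.torsion ℤ_[p] N := fun x hx ↦ by
      obtain ⟨n, hn, hnx⟩ := ((AddCommGroup.mem_torsion _).mp hx).exists_nsmul_eq_zero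
      rw [Submodule.mem_torsion_iff]
      refine ⟨⟨(n : ℤ_[p]), mem_nonZeroDivisors_of_ne_zero (by exact_mod_cast hn.ne')⟩, ?_⟩
      show (n : ℤ_[p]) • x = 0
      rw [Nat.cast_smul_eq_nsmul]
      exact hnx
    haveI : Finite (AddCommGroup.torsion N) :=
      Finite.of_injective (fun x : AddCommGroup.torsion N ↦
        (⟨(x : N), hsub' x x.2⟩ : Submodule.torsion ℤ_[p] N))
        (fun a b h ↦ Subtype.ext (by simpa using congrArg Subtype.val h))
    exact Nat.card_le_card_of_injective
      (fun x : N[(p : ℤ)] ↦ (⟨(x : N), hsub x x.2⟩ : AddCommGroup.torsion N))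
      (fun a b h ↦ Subtype.ext (by simpa using congrArg Subtype.val h))
  calc Nat.card S[(p : ℤ)] = Nat.card (CharacterModule (S[(p : ℤ)])) :=
        (PontryaginCard.natCard_characterModule_of_finite _).symm
    _ ≤ Nat.card (ModN (CharacterModule S) p) := Nat.card_le_card_of_surjective r hrsurj
    _ = Nat.card (ModN N p) := Nat.card_congr (modNEquiv Ψ p).symm.toEquiv
    _ = p ^ Module.finrank ℤ_[p] N * Nat.card N[(p : ℤ)] := ZpCorank.natCard_modN_eq p N
    _ ≤ p ^ Module.finrank ℤ_[p] N * Nat.card (AddCommGroup.torsion N) :=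
        Nat.mul_le_mul_left _ htorsle

/-- **The torsion subgroup of a finitely generated `ℤ_p`-module is a finite `p`-group**: it lies in
the torsion submodule, which is finite and killed by a power of `p` (`ZpCorank.finite_torsion`,
`exists_pow_smul_torsion_eq_zero`). [folklore] -/
theorem exists_natCard_torsion_eq_pow {N : Type*} [AddCommGroup N] [Module ℤ_[p] N]
    [Module.Finite ℤ_[p] N] :
    Finite (AddCommGroup.torsion N) ∧ ∃ j : ℕ, Nat.card (AddCommGroup.torsion N) = p ^ j := by
  haveI hfinT : Finite (Submodule.torsion ℤ_[p] N) := ZpCorank.finite_torsion p N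
  have hsub' : ∀ x : N, x ∈ AddCommGroup.torsion N → x ∈ Submodule.torsion ℤ_[p] N := fun x hx ↦ by
    obtain ⟨n, hn, hnx⟩ := ((AddCommGroup.mem_torsion _).mp hx).exists_nsmul_eq_zero
    rw [Submodule.mem_torsion_iff]
    refine ⟨⟨(n : ℤ_[p]), mem_nonZeroDivisors_of_ne_zero (by exact_mod_cast hn.ne')⟩, ?_⟩
    show (n : ℤ_[p]) • x = 0
    rw [Nat.cast_smul_eq_nsmul]
    exact hnx
  haveI hfin : Finite (AddCommGroup.torsion N) :=
    Finite.of_injective (fun x : AddCommGroup.torsion N ↦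
      (⟨(x : N), hsub' x x.2⟩ : Submodule.torsion ℤ_[p] N))
      (fun a b h ↦ Subtype.ext (by simpa using congrArg Subtype.val h))
  refine ⟨hfin, ?_⟩
  obtain ⟨m, hm⟩ := ZpCorank.exists_pow_smul_torsion_eq_zero p N
  have hprim : ∀ x : AddCommGroup.torsion N, p ^ m • x = 0 := fun x ↦ by
    apply Subtype.ext
    have h := hm (x : N) (hsub' x x.2)
    rw [← Nat.cast_pow, Nat.cast_smul_eq_nsmul] at h
    rw [AddSubmonoidClass.coe_nsmul]
    exact h
  have hG : IsPGroup p (Multiplicative (AddCommGroup.torsion N)) := fun x ↦ by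
    refine ⟨m, ?_⟩
    apply Multiplicative.toAdd.injective
    rw [toAdd_pow, toAdd_one]
    exact hprim _
  obtain ⟨j, hj⟩ := IsPGroup.iff_card.mp hG
  exact ⟨j, by rw [← hj]; exact (Nat.card_congr Multiplicative.toAdd).symm⟩

end Algebra

/-! ## §2 Pulling a dual pair back along an isomorphism of the discrete side -/

section Pullback

variable {p : ℕ} [Fact p.Prime] {S S' : Type*} [AddCommGroup S] [AddCommGroup S']
  {ψ : AddMonoid.End S} {ψ' : AddMonoid.End S'}
  {X : Type*} [AddCommGroup X] [Module (IwasawaAlgebra p) X]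
  {toDual' : X →+ (S' →+ AddCircle (1 : ℚ))}

/-- **A dual pair pulls back along an isomorphism of the discrete side.** If `(S', ψ') ↔ X` is a dual
pair (`IsDualPair`), `Φ : S ≃+ S'` satisfies `Φ (ψ s) = ψ' (Φ s)` and `(p, ψ)` is locally nilpotent
on `S`, then `x ↦ toDual' x ∘ Φ` makes `(S, ψ) ↔ X` a dual pair on the SAME module `X`.
[cite: GreenbergLNM1716, §1 (p. 60)] -/
theorem isDualPair_comp_addEquiv (h' : IsDualPair p ψ' toDual') (Φ : S ≃+ S')
    (hΦ : ∀ s, Φ (ψ s) = ψ' (Φ s)) (hψ : IsLocNil p ψ) :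
    IsDualPair p ψ ((AddMonoidHom.compHom' Φ.toAddMonoidHom).comp toDual') where
  bijective := by
    constructor
    · intro x y hxy
      apply h'.bijective.1
      refine AddMonoidHom.ext fun s' ↦ ?_
      have h := DFunLike.congr_fun hxy (Φ.symm s')
      change toDual' x (Φ (Φ.symm s')) = toDual' y (Φ (Φ.symm s')) at h
      rwa [AddEquiv.apply_symm_apply] at h
    · intro φ
      obtain ⟨x, hx⟩ := h'.bijective.2 (φ.comp Φ.symm.toAddMonoidHom)
      refine ⟨x, AddMonoidHom.ext fun s ↦ ?_⟩
      change toDual' x (Φ s) = φ s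
      rw [hx, AddMonoidHom.comp_apply, AddEquiv.coe_toAddMonoidHom, AddEquiv.symm_apply_apply]
  T_smul x s := by
    change toDual' (PowerSeries.X • x) (Φ s) = toDual' x (Φ (ψ s))
    rw [h'.T_smul, hΦ]
  C_smul c x s k hk := by
    change toDual' (PowerSeries.C c • x) (Φ s) = (PadicInt.toZModPow k c).val • toDual' x (Φ s)
    exact h'.C_smul c x (Φ s) k (by rw [← map_nsmul, hk, map_zero])
  locNil := hψ

end Pullback

/-! ## §3 Every `η`-datum of `V` is Pontryagin dual to `Sel⁺(W/ℚ_∞)` in `W`-coordinates -/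

section Transport

variable {V : WeierstrassCurve ℚ} {p : ℕ} [hp : Fact p.Prime]

/-- **`X⁺(V/K₀ℚ_∞)^η` IS Pontryagin dual to `Sel⁺(W/ℚ_∞)` with `T = conj_γ − 1`, on the datum's own
module.** For the odd prime `p`, `W/ℚ` with `C • W.quadraticTwist ((−1)^{p/2} p) = V` (`V` globally
minimal, good at `p`, `a_p = 0`), `K₀` an abstract `ℚ(μ_p)` with THE quadratic character `ηq` of
`Gal(K₀/ℚ)`, `κ` cyclotomic with topological generator `γ ∈ Gal(ℚ̄/K₀)`, and ANY
`D : EtaSignedSelmerDualData V κ K₀ ℚ_[p] ηq γ 1`: there is `toDualW : D.X → Hom(Sel⁺(W/ℚ_∞), ℚ/ℤ)`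
with `IsDualPair p (conj_γ − 1) toDualW` — ctrl's Selmer dictionary (D3⁺)
`Θ_∞(Sel⁺(W/ℚ_∞)) = Sel⁺(V/K₀ℚ_∞)^η` (an isomorphism `Φ`), `Θ_∞ ∘ conj_γ = η(γ)·conj_γ ∘ Θ_∞` with
`η(γ) = 1`, and §2. [cite: Kobayashi2003, Def. 2.1 (p. 5), §3 p. 5, §4 p. 8] [cite: GreenbergLNM1716, §1 (p. 60)] -/
theorem exists_isDualPair_strictSigned_of_eta
    (W : WeierstrassCurve ℚ) [W.IsElliptic] (C : VariableChange ℚ)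
    (hp2 : p ≠ 2) (hCV : C • W.quadraticTwist ((-1) ^ (p / 2) * p) = V)
    {K₀ : Type} [Field K₀] [NumberField K₀] [IsCyclotomicExtension {p} ℚ K₀]
    [(galRange (K := ℚ) K₀).Normal] {ηq : absoluteGaloisGroup ℚ →* ℤˣ}
    (hηK : ∀ σ ∈ galRange (K := ℚ) K₀, ηq σ = 1) (hη1 : ηq ≠ 1)
    {κ : ZpExtension ℚ p} {γ : absoluteGaloisGroup ℚ} (hκ : κ.IsCyclotomic) (hγ : κ.IsTopGenerator γ)
    (hγK : γ ∈ galRange (K := ℚ) K₀) (D : EtaSignedSelmerDualData V κ K₀ ℚ_[p] ηq γ 1) :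
    ∃ toDualW : D.X →+ (strictSignedSelmerInfty W κ ℚ_[p] 1 →+ AddCircle (1 : ℚ)),
      IsDualPair p (conjStrictSignedSelmerInfty W κ ℚ_[p] 1 γ - 1) toDualW := by
  -- the twist data at `K₀` (verbatim k8-rung / ctrl)
  obtain ⟨θ₀, hθ₀2⟩ := exists_sq_eq_pStar p K₀ hp2
  have hc₀ : θ₀ ^ 2 = algebraMap ℚ K₀ ((-1) ^ (p / 2) * p) := by
    rw [hθ₀2, map_mul, map_pow, map_neg, map_one, map_natCast]
  have hθ₀ : θ₀ ∉ Set.range (algebraMap ℚ K₀) := by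
    rintro ⟨r, hr⟩
    apply forall_sq_ne_pStar p r
    apply (algebraMap ℚ K₀).injective
    rw [map_pow, hr, hc₀]
  have hη : ∀ σ, ηq σ = 1 ↔ σ • rootInClosure K₀ θ₀ = rootInClosure K₀ θ₀ :=
    eta_eq_one_iff_smul_rootInClosure p K₀ hθ₀ hc₀ ηq hηK hη1
  have hDK := localTowerHyp_padic p κ K₀ hκ
  have hκ₀ : ∀ x, ∃ g ∈ galRange (K := ℚ) K₀, κ g = x := kappa_surjOn_galRange_cyclotomic κ K₀
  have hcop : (galRange (K := ℚ) K₀).index.Coprime p := coprime_index_galRange_cyclotomic p K₀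
  have hγγ : γ⁻¹ * γ ∈ κ.kerSubgroup := by rw [inv_mul_cancel]; exact one_mem _
  -- (D3⁺): the Selmer-level isomorphism `Φ = Θ_∞`
  have hD3 := map_h1TransportInfty_strictSignedSelmerInfty_one W K₀ hθ₀ hc₀ p κ hCV ℚ_[p] ηq hη hDK hκ₀ hcop
  obtain ⟨Φ, hΦ⟩ : ∃ Φ : strictSignedSelmerInfty W κ ℚ_[p] 1 ≃+ towerSignedSelmerInftyEta V κ K₀ ℚ_[p] ηq 1,
      ∀ s, ((Φ s : towerSignedSelmerInftyEta V κ K₀ ℚ_[p] ηq 1) : V.subgroupH1 p (towerTopSubgroup κ K₀)) =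
        h1TransportInfty W K₀ hθ₀ hc₀ p κ hCV s :=
    ⟨((strictSignedSelmerInfty W κ ℚ_[p] 1).equivMapOfInjective (h1TransportInfty W K₀ hθ₀ hc₀ p κ hCV)
        (h1TransportInfty_injective W K₀ hθ₀ hc₀ p κ hCV hcop)).trans (AddEquiv.addSubgroupCongr hD3),
      fun _ ↦ rfl⟩
  -- Galois bookkeeping: `Φ (conj_γ s) = conj_γ (Φ s)`
  have hconj : ∀ s : strictSignedSelmerInfty W κ ℚ_[p] 1,
      Φ (conjStrictSignedSelmerInfty W κ ℚ_[p] 1 γ s) =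
        conjTowerSignedSelmerInftyEta V κ K₀ ℚ_[p] ηq 1 γ (Φ s) := by
    intro s
    apply Subtype.ext
    rw [coe_conjTowerSignedSelmerInftyEta_apply, hΦ, coe_conjStrictSignedSelmerInfty_apply,
      h1TransportInfty_conjH1 W K₀ hθ₀ hc₀ p κ hCV ηq hη γ s, ← hΦ]
    exact (conjH1_eq_eta_smul_conjH1_of_mem_etaSigned K₀ p κ ηq hη ℚ_[p] 1 hγK hγγ (Φ s).2).symm
  have hconj' : ∀ s : strictSignedSelmerInfty W κ ℚ_[p] 1,
      Φ ((conjStrictSignedSelmerInfty W κ ℚ_[p] 1 γ - 1) s) =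
        (conjTowerSignedSelmerInftyEta V κ K₀ ℚ_[p] ηq 1 γ - 1) (Φ s) := fun s ↦ by
    rw [IwasawaDual.End_sub_apply, IwasawaDual.End_sub_apply, AddMonoid.End.one_apply,
      AddMonoid.End.one_apply, map_sub, hconj]
  exact ⟨_, isDualPair_comp_addEquiv (EtaSignedSelmerDualData.isDualPair V κ K₀ ℚ_[p] ηq 1 D hκ₀ hγ hγK)
    Φ hconj' (isLocNil_conjStrictSignedSelmerInfty_sub_one W κ ℚ_[p] 1 hγ)⟩

end Transport

/-! ## §4 The bottom-layer control bijection on the `p^m`-torsion -/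

section Control

open scoped AddSubgroup

variable {K : Type} [Field K] [NumberField K] (W : WeierstrassCurve K) {p : ℕ} [hp : Fact p.Prime]
  {κ : ZpExtension K p} {γ : Field.absoluteGaloisGroup K}

/-- **`h₀ : A₀ = h₀⁻¹(S_∞) ≅ S_∞^{ψ=0}` restricted to the `n`-torsion**, for ANY subgroup
`S_∞ ≤ H¹(K_∞, E[p^∞])` with an endomorphism `ψ` acting as `conj_γ − 1` (`γ` a topological generator
of `Gal(K_∞/K)`) and `E(K_∞)[p^∞] = 0` (`hB`): `#(A₀ ∩ H¹(K, E[p^∞])[n]) = #(S_∞^{ψ=0}[n])`. Injective by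
[K] Lemma 9.1 (`layerToInfty_zero_injective`), onto by Greenberg's Lemma 3.2
(`exists_layerToInfty_eq_of_mem_endInvariants`); `h₀` is additive, so it respects `n`-torsion.
[cite: GreenbergLNM1716, §3 Lemma 3.1–3.2 (p. 86)] [cite: Kobayashi2003, Lemma 9.1 (p. 25)] -/
theorem natCard_comap_inf_torsionBy_eq (hγ : κ.IsTopGenerator γ)
    (hB : FixedPoints.addSubgroup κ.kerSubgroup (W.geomPrimaryTorsion p) = ⊥)
    {Sinf : AddSubgroup (W.subgroupH1 p κ.kerSubgroup)} {ψ : AddMonoid.End Sinf}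
    (hψ : ∀ s : Sinf, ((ψ s : Sinf) : W.subgroupH1 p κ.kerSubgroup) =
      W.conjH1 p κ.kerSubgroup γ (s : W.subgroupH1 p κ.kerSubgroup) - s) (n : ℕ) :
    Nat.card ↥(Sinf.comap (W.layerToInfty κ 0) ⊓
        AddSubgroup.torsionBy (W.subgroupH1 p (κ.layerSubgroup 0)) (n : ℤ)) =
      Nat.card ↥((↥(endInvariants ψ))[(n : ℤ)]) := by
  set A₀ := Sinf.comap (W.layerToInfty κ 0) with hA₀
  -- `h₀ : A₀ → S_∞^{ψ=0}` as an additive map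
  have hmemS : ∀ y : W.subgroupH1 p (κ.layerSubgroup 0), y ∈ A₀ → W.layerToInfty κ 0 y ∈ Sinf :=
    fun y hy ↦ AddSubgroup.mem_comap.mp hy
  have hfix : ∀ (y : W.subgroupH1 p (κ.layerSubgroup 0)) (hy : y ∈ A₀),
      (⟨W.layerToInfty κ 0 y, hmemS y hy⟩ : Sinf) ∈ endInvariants ψ := by
    intro y hy
    rw [mem_endInvariants_iff]
    apply Subtype.ext
    rw [hψ, ZeroMemClass.coe_zero, sub_eq_zero]
    have hinv := W.range_layerToInfty_le_layerInvariants_holds κ 0 ⟨y, rfl⟩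
    rw [mem_layerInvariants_iff] at hinv
    exact hinv γ (by rw [ZpExtension.layerSubgroup_zero]; exact Subgroup.mem_top γ)
  let Φ : A₀ →+ endInvariants ψ :=
    { toFun := fun y ↦ ⟨⟨W.layerToInfty κ 0 (y : W.subgroupH1 p (κ.layerSubgroup 0)), hmemS y y.2⟩, hfix y y.2⟩
      map_zero' := Subtype.ext (Subtype.ext (by simp))
      map_add' := fun a b ↦ Subtype.ext (Subtype.ext (by simp)) }
  have hΦ : ∀ y : A₀, (((Φ y : endInvariants ψ) : Sinf) : W.subgroupH1 p κ.kerSubgroup) =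
      W.layerToInfty κ 0 (y : W.subgroupH1 p (κ.layerSubgroup 0)) := fun _ ↦ rfl
  have hΦinj : Function.Injective Φ := fun a b hab ↦ by
    have h := congrArg (fun z : endInvariants ψ ↦ ((z : Sinf) : W.subgroupH1 p κ.kerSubgroup)) hab
    simp only [hΦ] at h
    exact Subtype.ext (SignedControlZero.layerToInfty_zero_injective W hγ hB h)
  have hΦsurj : Function.Surjective Φ := by
    rintro ⟨s, hs⟩
    obtain ⟨y, hyA, hy⟩ := SubSelmerControlZero.exists_layerToInfty_eq_of_mem_endInvariants W hγ hψ hs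
    exact ⟨⟨y, hyA⟩, Subtype.ext (Subtype.ext hy)⟩
  -- restrict to the `n`-torsion
  let T : ↥(A₀ ⊓ AddSubgroup.torsionBy (W.subgroupH1 p (κ.layerSubgroup 0)) (n : ℤ)) →
      ↥((↥(endInvariants ψ))[(n : ℤ)]) := fun y ↦
    ⟨Φ ⟨y, (AddSubgroup.mem_inf.mp y.2).1⟩, by
      rw [AddSubgroup.torsionBy.nsmul_iff, ← map_nsmul]
      have hy : n • (y : W.subgroupH1 p (κ.layerSubgroup 0)) = 0 :=
        AddSubgroup.torsionBy.nsmul_iff.mp (AddSubgroup.mem_inf.mp y.2).2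
      have h0 : n • (⟨y, (AddSubgroup.mem_inf.mp y.2).1⟩ : A₀) = 0 := Subtype.ext hy
      rw [h0, map_zero]⟩
  refine Nat.card_eq_of_bijective T ⟨fun a b hab ↦ ?_, fun s ↦ ?_⟩
  · have h := hΦinj (congrArg Subtype.val hab)
    exact Subtype.ext (congrArg (fun z : A₀ ↦ (z : W.subgroupH1 p (κ.layerSubgroup 0))) h)
  · obtain ⟨y, hy⟩ := hΦsurj (s : endInvariants ψ)
    have hny : n • y = 0 := by
      apply hΦinj
      rw [map_nsmul, hy, map_zero]
      exact AddSubgroup.torsionBy.nsmul_iff.mp s.2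
    refine ⟨⟨y, AddSubgroup.mem_inf.mpr ⟨y.2, AddSubgroup.torsionBy.nsmul_iff.mpr ?_⟩⟩, ?_⟩
    · exact congrArg Subtype.val hny
    · apply Subtype.ext
      change Φ ⟨y, _⟩ = (s : endInvariants ψ)
      rw [← hy]

/-- **`#Sel^{loc,∞,+}(W/ℚ)[p^m] = #Sel⁺(W/ℚ_∞)^Γ[p^m]` for the `p*`-twist** `W` of a globally minimal
good `a_p = 0` curve `V` (`p` odd), `κ` a `ℤ_p`-extension with topological generator `γ`:
`Sel^{loc,∞,+}` in ctrl's B2 form (classes over `ℚ` restricting into `Sel_{p^∞}(W/ℚ_∞)` and into the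
level-`∞` plus Kummer condition at every conjugate), `Sel⁺(W/ℚ_∞)^Γ = ker(conj_γ − 1)` on
`strictSignedSelmerInfty W κ ℚ_[p] 1`. The previous theorem with `W(ℚ_∞)[p^∞] = 0` and B2 discharged
(x1b file 55 / 49: `fixedPoints_kerSubgroup_geomPrimaryTorsion_eq_bot_of_quadraticTwist`,
`comap_layerToInfty_zero_strictSignedSelmerInfty_eq`). [cite: GreenbergLNM1716, §3 Lemma 3.1–3.2 (p. 86)]
[cite: Kobayashi2003, Prop. 8.7 (p. 16), Lemma 9.1 (p. 25)] -/
theorem natCard_localPreimage_inf_torsionBy_eq {p : ℕ} [hp : Fact p.Prime] (κ : ZpExtension ℚ p)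
    (W : WeierstrassCurve ℚ) [W.IsElliptic] (hp2 : p ≠ 2) (Cv : VariableChange ℚ) (V : WeierstrassCurve ℚ)
    [V.IsElliptic] [V.IsGloballyMinimal] (hCV : Cv • W.quadraticTwist ((-1) ^ (p / 2) * p) = V)
    (hgood : V.HasGoodReductionAtPrime p) (hap : V.frobeniusTrace p = 0)
    {γ : absoluteGaloisGroup ℚ} (hγ : κ.IsTopGenerator γ) (m : ℕ) :
    Nat.card ↥((W.selmerInfty κ ⊓ ⨅ σ : absoluteGaloisGroup ℚ,
          (localKummerOverOfEmb W p κ.kerSubgroup (closureEmb (K := ℚ) ℚ_[p])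
            (⨆ n, strictSignedLocalPoints κ ℚ_[p] W 1 n)).comap
              (W.conjH1 p κ.kerSubgroup σ)).comap (W.layerToInfty κ 0) ⊓
        AddSubgroup.torsionBy (W.subgroupH1 p (κ.layerSubgroup 0)) ((p ^ m : ℕ) : ℤ)) =
      Nat.card ↥((↥(endInvariants (conjStrictSignedSelmerInfty W κ ℚ_[p] 1 γ - 1)))[((p ^ m : ℕ) : ℤ)]) := by
  obtain ⟨M, hΔ, hA, hVM⟩ := exists_goodSupersingularPadicModel hp2 V hgood hap
  obtain ⟨S, hS⟩ := exists_finset_forall_not_mem_good W p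
  have hc := sq_ne_neg_one_pow_mul_prime hp.out (p / 2)
  have hB := fixedPoints_kerSubgroup_geomPrimaryTorsion_eq_bot_of_quadraticTwist κ hp2 W hc Cv hCV M hΔ hA hVM
  have htors := eq_zero_of_prime_pow_smul_eq_zero_localFixedPointsOfEmb_kerSubgroup_of_quadraticTwist κ
    (closureEmb (K := ℚ) ℚ_[p]) hp2 W hc Cv hCV M hΔ hA hVM
  rw [← comap_layerToInfty_zero_strictSignedSelmerInfty_eq W κ ℚ_[p] 1 S hS htors]
  exact natCard_comap_inf_torsionBy_eq W hγ hB (coe_conjStrictSignedSelmerInfty_sub_one_apply W κ ℚ_[p] 1 γ)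
    (p ^ m)

end Control



end TamagawaRoad

end Summit.BirchSwinnertonDyer.BirchSwinnertonDyer.Theorems

end
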